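import Summits.ValiantsHypothesis.ValiantsHypothesis.Theorems.GrenetZeonDualUnipotentThreeHalvesLongMassLedgerBorelFamily

/-!
# PART VIII-b (the unipotent-closure theorem `exists_stable_of_expStable`) + PART IX (joint Borel normal form ★★ `exists_graded_stable`) — Theorems-side port of val-idea-28 g5's staged `…LongMassLedgerBorel.lean` (sha16 778689f35a337204, 681 l.; Parts VIII–IX of
# `Cruxes/DualUnipotentThreeHalves/InitialForm.lean` rev 14 @11411eb80f60; crit-7 V40 «CORRECT INSTRUMENT», V36 §B; desk val-lit #420 «port-3's next»)

PORT NOTE.  Decl texts VERBATIM BY NAME, namespaces as staged (`…InitialForm.UnipotentClosure` / `.LedgerUnipotent`); the ONLY changes are the 400-line-cap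
SPLIT into three chained modules `GrenetZeonDualUnipotentThreeHalvesLongMassLedgerBorel{Family, Closure, ∅}.lean` (this file imports `GrenetZeonDualUnipotentThreeHalvesLongMassLedgerBorelFamily`; the `UnipotentClosure` namespace is re-opened in
`…Closure.lean` with the same `open`s and `variable {ι} [Fintype ι] [DecidableEq ι] {K}` context), these headers, and one-line docstrings where the gate's
`lint.docstring` requires them.  `--supports stmt-ValiantsHypothesis-24318` helper.  ALL CREDIT: val-idea-28 g5.  HONEST STATUS (author's): INSTRUMENT — the
normal form of (c)-certificates under a unipotent symmetry normalised by a torus; proves NO case of (c) `SlowCore.LongMassSlowLawInv`, NOT progress on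
(c); 24318 OPEN; VP ≠ VNP is NOT proved.  The author's full module docstring is reproduced in `GrenetZeonDualUnipotentThreeHalvesLongMassLedgerBorelFamily.lean`.
-/

set_option linter.dupNamespace false

noncomputable section

namespace Summit.ValiantsHypothesis.ValiantsHypothesis.Theorems.GrenetZeon.InitialForm.UnipotentClosure

open Summit.ValiantsHypothesis.ValiantsHypothesis.Theorems.GrenetZeon.InitialForm.CurveClosure Matrix
open scoped Nat Polynomial

variable {ι : Type*} [Fintype ι] [DecidableEq ι]
variable {K : Submodule ℂ (ι → ℂ)}

/-! ### The theorem -/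

/-- ★ **UNIPOTENT CLOSURE.**  Let `A` be a nilpotent matrix acting on the coordinate space and `𝓕` a family of polynomial conditions.
If the whole orbit `exp(u A) · K` (`u ∈ ℂ`) of a subspace `K` lies in the zero locus of `𝓕`, then there is a subspace `K₀` of the SAME
dimension, contained in the zero locus, and `A`-STABLE (`K₀ = lim_{u → ∞} exp(u A) K`, computed as the canonical curve-closure limit of the
algebraic family `s^D exp(A/s) K[s]` at `s = 0`; stability because the family is invariant under the polynomial Möbius reparametrisation
`s ↦ s/(1+us)` composed with `exp(u A)`).  The kernel form of «a certificate may be taken fixed by a unipotent symmetry» (Borel). -/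
theorem exists_stable_of_expStable_core (A : Matrix ι ι ℂ) (hA : IsNilpotent A) (K : Submodule ℂ (ι → ℂ))
    (𝓕 : Set (MvPolynomial ι ℂ)) (hK : ∀ u : ℂ, ∀ k ∈ K, ∀ F ∈ 𝓕, MvPolynomial.eval (IsNilpotent.exp (u • A) *ᵥ k) F = 0) :
    ∃ K₀ : Submodule ℂ (ι → ℂ), Module.finrank ℂ K₀ = Module.finrank ℂ K ∧ (∀ v ∈ K₀, A *ᵥ v ∈ K₀) ∧
      (∀ v ∈ K₀, ∀ F ∈ 𝓕, MvPolynomial.eval v F = 0) ∧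
      ∀ (G : Matrix ι ι ℂ) (c : ℂ), c ≠ 0 → (∀ k ∈ K, G *ᵥ k ∈ K) → G * A = c • (A * G) → ∀ v ∈ K₀, G *ᵥ v ∈ K₀ := by
  classical
  obtain ⟨D, hD⟩ := hA
  have hA1 : A ^ (D + 1) = 0 := by rw [pow_succ, hD, zero_mul]
  have hAnil : IsNilpotent A := ⟨D, hD⟩
  set N := Nfam K A D with hN
  set 𝓕' : Set (MvPolynomial ι ℂ[X]) := (MvPolynomial.map Polynomial.C) '' 𝓕 with h𝓕'
  set T : Set ℂ := {t | t ≠ 0} with hT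
  have hTinf : T.Infinite := by
    have : T = Set.univ \ {0} := by ext t; simp [hT]
    rw [this]; exact Set.infinite_univ.sdiff (Set.finite_singleton 0)
  have hT0 : (0 : ℂ) ∉ T := fun h => h rfl
  have hmapC : ∀ (t : ℂ) (F : MvPolynomial ι ℂ),
      MvPolynomial.map (Polynomial.evalRingHom t) (MvPolynomial.map Polynomial.C F) = F := by
    intro t F
    rw [MvPolynomial.map_map]
    have : (Polynomial.evalRingHom t).comp Polynomial.C = RingHom.id ℂ := RingHom.ext fun c => Polynomial.eval_C
    rw [this, MvPolynomial.map_id]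
  have hS : ∀ t ∈ T, ∀ p ∈ N, ∀ F ∈ 𝓕', MvPolynomial.eval (ev t p) (MvPolynomial.map (Polynomial.evalRingHom t) F) = 0 := by
    rintro t ht p hp _ ⟨F, hF, rfl⟩
    rw [hmapC]
    obtain ⟨k, hk, hev⟩ := ev_Nfam hA1 hp ht
    rw [hev]; exact hK _ k hk F hF
  obtain ⟨K₀, hdim, hinit, hcanon, hzero⟩ := exists_limit_of_algebraic_family' N 𝓕' T hTinf hT0 hS
  -- exp-stability of the canonical limit
  have hexp : ∀ u : ℂ, ∀ v ∈ K₀, IsNilpotent.exp (u • A) *ᵥ v ∈ K₀ := by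
    intro u v hv
    obtain ⟨w, hw0, C, hwN⟩ := hinit v hv
    set E := Finset.univ.sup fun e => (w e).natDegree with hE
    have hwE : ∀ e, (w e).natDegree ≤ E := fun e => Finset.le_sup (f := fun e => (w e).natDegree) (Finset.mem_univ e)
    -- the moved polynomial vector
    set w' : ι → ℂ[X] := (IsNilpotent.exp (u • A)).map Polynomial.C *ᵥ mobv (-u) E w with hw'
    have hev' : ∀ t : ℂ, t ≠ 0 → 1 + (-u) * t ≠ 0 → ∃ p ∈ N, ev t p = ev t w' := by
      intro t ht hut
      set t' := t / (1 + (-u) * t) with ht'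
      have ht'0 : t' ≠ 0 := div_ne_zero ht hut
      -- `ev t' w ∈ exp(A/t') K`
      obtain ⟨k, hk, hk'⟩ := ev_Nfam hA1 hwN ht'0
      have hevw : ev t' w = IsNilpotent.exp (t'⁻¹ • A) *ᵥ ((t' ^ C)⁻¹ • k) := by
        have h1 : ev t' (((Polynomial.X : ℂ[X]) ^ C) • w) = t' ^ C • ev t' w := by
          rw [ev_smul_poly, Polynomial.eval_pow, Polynomial.eval_X]
        rw [Matrix.mulVec_smul, ← hk', h1, smul_smul, inv_mul_cancel₀ (pow_ne_zero _ ht'0), one_smul]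
      have hinv : t'⁻¹ = t⁻¹ + -u := by
        rw [ht', inv_div]; field_simp
      obtain ⟨p, hp, hpev⟩ := exp_mulVec_mem_ev_Nfam (K := K) hA1 ht
        (K.smul_mem ((1 + (-u) * t) ^ E) (K.smul_mem ((t' ^ C)⁻¹) hk))
      refine ⟨p, hp, ?_⟩
      rw [hpev, hw', ev_mulVec, map_C_map_eval, ev_mobv (-u) hwE hut, ← ht', hevw]
      simp only [Matrix.mulVec_smul, Matrix.mulVec_mulVec]
      rw [exp_smul_mul_exp_smul hAnil, hinv, show u + (t⁻¹ + -u) = t⁻¹ by ring]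
    have hinf : Set.Infinite {t : ℂ | ∃ p ∈ N, ev t p = ev t w'} := by
      have hfin : Set.Finite ({0} ∪ {t : ℂ | 1 + (-u) * t = 0}) := by
        refine (Set.finite_singleton 0).union (Set.Finite.subset (Set.finite_singleton (u⁻¹)) ?_)
        intro t ht
        have ht' : 1 + (-u) * t = 0 := ht
        have hu : u ≠ 0 := by rintro rfl; simp at ht'
        rw [Set.mem_singleton_iff]
        field_simp
        linear_combination -ht'
      refine (Set.infinite_univ.sdiff hfin).mono ?_
      intro t ht
      simp only [Set.mem_sdiff, Set.mem_univ, Set.mem_union, Set.mem_singleton_iff, Set.mem_setOf_eq, true_and, not_or] at ht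
      exact hev' t ht.1 ht.2
    have hmem := hcanon w' hinf
    rw [hw', ev_mulVec, map_C_map_eval, ev_zero_mobv, hw0] at hmem
    exact hmem
  refine ⟨K₀, by rw [hdim, hN, finrank_Nfam hA1], ?_, ?_, ?_⟩
  · intro v hv
    by_contra hAv
    obtain ⟨ℓ, hφv, hφK⟩ := Submodule.exists_dual_map_eq_bot_of_notMem hAv inferInstance
    have hφ0 : ∀ x ∈ K₀, ℓ x = 0 := fun x hx => (Submodule.eq_bot_iff _).mp hφK (ℓ x) (Submodule.mem_map_of_mem hx)
    rcases Nat.eq_zero_or_pos D with hD0 | hDpos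
    · -- degenerate: `A ^ 0 = 1 = 0`
      subst hD0
      apply hAv
      have h1 : (1 : Matrix ι ι ℂ) = 0 := by simpa using hD
      have : A *ᵥ v = 0 := by rw [← Matrix.one_mulVec (A *ᵥ v), h1, Matrix.zero_mulVec]
      rw [this]; exact K₀.zero_mem
    set P : ℂ[X] := ∑ i ∈ Finset.range (D + 1), Polynomial.C (((i ! : ℂ))⁻¹ * ℓ (A ^ i *ᵥ v)) * Polynomial.X ^ i with hP
    have hPeval : ∀ u : ℂ, P.eval u = ℓ (IsNilpotent.exp (u • A) *ᵥ v) := by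
      intro u
      rw [exp_smul_eq_sum' hA1, Matrix.sum_mulVec, map_sum, hP, Polynomial.eval_finsetSum]
      refine Finset.sum_congr rfl fun i _ => ?_
      rw [Matrix.smul_mulVec, Matrix.smul_mulVec, map_smul, map_smul, smul_eq_mul, smul_eq_mul,
        Polynomial.eval_mul, Polynomial.eval_C, Polynomial.eval_pow, Polynomial.eval_X]
      ring
    have hP0 : P = 0 := by
      apply Polynomial.funext
      intro u
      rw [hPeval, Polynomial.eval_zero]
      exact hφ0 _ (hexp u v hv)
    have hcoeff := congrArg (fun p : ℂ[X] => p.coeff 1) hP0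
    simp only [hP, Polynomial.finsetSum_coeff, Polynomial.coeff_C_mul_X_pow, Polynomial.coeff_zero] at hcoeff
    rw [Finset.sum_eq_single 1] at hcoeff
    · simp only [if_true, Nat.factorial_one, Nat.cast_one, inv_one, one_mul, pow_one] at hcoeff
      exact hφv hcoeff
    · intro i _ hi; rw [if_neg (Ne.symm hi)]
    · intro h; exact absurd (Finset.mem_range.mpr (Nat.succ_lt_succ hDpos)) h
  · intro v hv F hF
    have := hzero v hv (MvPolynomial.map Polynomial.C F) ⟨F, hF, rfl⟩
    rwa [hmapC] at this
  · -- stability of the canonical limit under linear symmetries `G` of `K` normalising the one-parameter group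
    intro G c hc hGK hGA v hv
    obtain ⟨w, hw0, C, hwN⟩ := hinit v hv
    set w'' : ι → ℂ[X] := G.map Polynomial.C *ᵥ scl c w with hw''
    have hev'' : ∀ t : ℂ, t ≠ 0 → ∃ p ∈ N, ev t p = ev t w'' := by
      intro t ht
      obtain ⟨k, hk, hkev⟩ := ev_sat_mem (K := K) hA1 hwN (mul_ne_zero hc ht)
      obtain ⟨p, hp, hpev⟩ := exp_mulVec_mem_ev_Nfam (K := K) hA1 ht (hGK k hk)
      refine ⟨p, hp, ?_⟩
      rw [hpev, hw'', ev_mulVec, map_C_map_eval, ev_scl, hkev, Matrix.mulVec_mulVec, Matrix.mulVec_mulVec,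
        mul_exp_smul_of_rel hGA hA1, show (c * t)⁻¹ * c = t⁻¹ by field_simp]
    have hinf : Set.Infinite {t : ℂ | ∃ p ∈ N, ev t p = ev t w''} :=
      hTinf.mono fun t ht => hev'' t ht
    have hmem := hcanon w'' hinf
    rw [hw'', ev_mulVec, map_C_map_eval, ev_scl, mul_zero, hw0] at hmem
    exact hmem

/-- ★ **UNIPOTENT CLOSURE** (the statement of record; `_core` carries in addition the stability of `K₀` under the linear symmetries of `K`
normalising the one-parameter group). -/
theorem exists_stable_of_expStable (A : Matrix ι ι ℂ) (hA : IsNilpotent A) (K : Submodule ℂ (ι → ℂ)) (𝓕 : Set (MvPolynomial ι ℂ))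
    (hK : ∀ u : ℂ, ∀ k ∈ K, ∀ F ∈ 𝓕, MvPolynomial.eval (IsNilpotent.exp (u • A) *ᵥ k) F = 0) :
    ∃ K₀ : Submodule ℂ (ι → ℂ), Module.finrank ℂ K₀ = Module.finrank ℂ K ∧ (∀ v ∈ K₀, A *ᵥ v ∈ K₀) ∧
      ∀ v ∈ K₀, ∀ F ∈ 𝓕, MvPolynomial.eval v F = 0 := by
  obtain ⟨K₀, h1, h2, h3, -⟩ := exists_stable_of_expStable_core A hA K 𝓕 hK
  exact ⟨K₀, h1, h2, h3⟩


/-! ### The joint (Borel) normal form: torus-graded AND `A`-stable -/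

/-- `torusAct_eq_diagonal_mulVec` — helper of this port (see the module docstring for its role). (docstring added in the port) -/
theorem torusAct_eq_diagonal_mulVec (w : ι → ℕ) (τ : ℂ) (v : ι → ℂ) :
    torusAct w τ v = (Matrix.diagonal fun e => τ ^ w e) *ᵥ v := by
  funext e; simp [torusAct, Matrix.mulVec_diagonal]

omit [DecidableEq ι] in
/-- A weight-graded subspace is torus-stable. -/
theorem torusAct_mem_of_graded (w : ι → ℕ) {K : Submodule ℂ (ι → ℂ)} (hgr : ∀ s ∈ K, ∀ c, wtProj w c s ∈ K) (τ : ℂ)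
    {v : ι → ℂ} (hv : v ∈ K) : torusAct w τ v ∈ K := by
  classical
  have : torusAct w τ v = ∑ c ∈ Finset.univ.image w, τ ^ c • wtProj w c v := by
    funext e
    simp only [torusAct, Finset.sum_apply, Pi.smul_apply, wtProj, smul_eq_mul, mul_ite, mul_zero]
    rw [Finset.sum_ite_eq (Finset.univ.image w) (w e) (fun c => τ ^ c * v e), if_pos (Finset.mem_image_of_mem w (Finset.mem_univ e))]
  rw [this]
  exact K.sum_mem fun c _ => K.smul_mem _ (hgr v hv c)

omit [DecidableEq ι] in
/-- ★ A torus-STABLE subspace is weight-GRADED (Part I applied to the subspace's own linear equations). -/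
theorem graded_of_torusStable (w : ι → ℕ) (K : Submodule ℂ (ι → ℂ)) (hK : ∀ τ : ℂ, τ ≠ 0 → ∀ v ∈ K, torusAct w τ v ∈ K) :
    ∀ s ∈ K, ∀ c, wtProj w c s ∈ K := by
  classical
  set 𝓛 : Set (MvPolynomial ι ℂ) := {F | ∃ ℓ : Module.Dual ℂ (ι → ℂ), (∀ x ∈ K, ℓ x = 0) ∧
    F = ∑ e, MvPolynomial.C (ℓ (Pi.single e 1)) * MvPolynomial.X e} with h𝓛
  have hevalL : ∀ (ℓ : Module.Dual ℂ (ι → ℂ)) (v : ι → ℂ),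
      MvPolynomial.eval v (∑ e, MvPolynomial.C (ℓ (Pi.single e 1)) * MvPolynomial.X e) = ℓ v := by
    intro ℓ v
    have hv : v = ∑ e, v e • (Pi.single e (1 : ℂ) : ι → ℂ) := by
      funext j
      simp only [Finset.sum_apply, Pi.smul_apply, Pi.single_apply, smul_eq_mul, mul_ite, mul_one, mul_zero]
      rw [Finset.sum_ite_eq Finset.univ j (fun e => v e), if_pos (Finset.mem_univ j)]
    conv_rhs => rw [hv, map_sum]
    simp only [map_sum, map_mul, MvPolynomial.eval_C, MvPolynomial.eval_X, map_smul, smul_eq_mul]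
    exact Finset.sum_congr rfl fun e _ => mul_comm _ _
  have hZ : ∀ τ : ℂ, τ ≠ 0 → ∀ v ∈ K, ∀ F ∈ 𝓛, MvPolynomial.eval (torusAct w τ v) F = 0 := by
    rintro τ hτ v hv _ ⟨ℓ, hℓ, rfl⟩
    rw [hevalL]; exact hℓ _ (hK τ hτ v hv)
  obtain ⟨K₀, hdim, hgr, hzero⟩ := exists_graded_of_torusStable w K 𝓛 hZ
  have hle : K₀ ≤ K := by
    intro s hs
    by_contra hsK
    obtain ⟨ℓ, hℓs, hℓK⟩ := Submodule.exists_dual_map_eq_bot_of_notMem hsK inferInstance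
    have h0 : ∀ x ∈ K, ℓ x = 0 := fun x hx => (Submodule.eq_bot_iff _).mp hℓK (ℓ x) (Submodule.mem_map_of_mem hx)
    have := hzero s hs _ ⟨ℓ, h0, rfl⟩
    rw [hevalL] at this
    exact hℓs this
  have heq : K₀ = K := Submodule.eq_of_le_of_finrank_eq hle hdim
  rw [← heq]
  exact hgr

/-- ★★ **JOINT (BOREL) NORMAL FORM — torus-graded AND `A`-stable.**  Let the torus `λ_w` and the unipotent group `exp(u·A)` (`A` nilpotent, a torus
weight vector up to scalars: `λ_w(τ) A = c_τ · A λ_w(τ)`) both preserve the zero locus of `𝓕`.  Then any subspace in the zero locus may be replaced by one of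
the SAME dimension that is WEIGHT-GRADED and `A`-STABLE (torus closure (Part I), then the canonical unipotent closure of the graded space, which stays
torus-stable because the torus normalises the one-parameter group and the canonical limit is reparametrisation-invariant, and torus-stable ⇒ graded). -/
theorem exists_graded_stable (w : ι → ℕ) (A : Matrix ι ι ℂ) (hA : IsNilpotent A)
    (hcomp : ∀ τ : ℂ, τ ≠ 0 → ∃ c : ℂ, c ≠ 0 ∧
      (Matrix.diagonal fun e => τ ^ w e) * A = c • (A * Matrix.diagonal fun e => τ ^ w e))
    (𝓕 : Set (MvPolynomial ι ℂ))
    (hZT : ∀ τ : ℂ, τ ≠ 0 → ∀ v : ι → ℂ, (∀ F ∈ 𝓕, MvPolynomial.eval v F = 0) → ∀ F ∈ 𝓕, MvPolynomial.eval (torusAct w τ v) F = 0)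
    (hZU : ∀ (u : ℂ) (v : ι → ℂ), (∀ F ∈ 𝓕, MvPolynomial.eval v F = 0) →
      ∀ F ∈ 𝓕, MvPolynomial.eval (IsNilpotent.exp (u • A) *ᵥ v) F = 0)
    (K : Submodule ℂ (ι → ℂ)) (hK : ∀ v ∈ K, ∀ F ∈ 𝓕, MvPolynomial.eval v F = 0) :
    ∃ K₀ : Submodule ℂ (ι → ℂ), Module.finrank ℂ K₀ = Module.finrank ℂ K ∧ (∀ s ∈ K₀, ∀ c, wtProj w c s ∈ K₀) ∧
      (∀ v ∈ K₀, A *ᵥ v ∈ K₀) ∧ ∀ v ∈ K₀, ∀ F ∈ 𝓕, MvPolynomial.eval v F = 0 := by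
  obtain ⟨K₁, hdim₁, hgr₁, hZ₁⟩ := exists_graded_of_torusStable w K 𝓕 (fun τ hτ v hv => hZT τ hτ v (hK v hv))
  have hT₁ : ∀ τ : ℂ, τ ≠ 0 → ∀ v ∈ K₁, torusAct w τ v ∈ K₁ := fun τ _ v hv => torusAct_mem_of_graded w hgr₁ τ hv
  obtain ⟨K₀, hdim₀, hA₀, hZ₀, hstab⟩ := exists_stable_of_expStable_core A hA K₁ 𝓕 (fun u k hk => hZU u k (hZ₁ k hk))
  have hT₀ : ∀ τ : ℂ, τ ≠ 0 → ∀ v ∈ K₀, torusAct w τ v ∈ K₀ := by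
    intro τ hτ v hv
    obtain ⟨c, hc, hGA⟩ := hcomp τ hτ
    rw [torusAct_eq_diagonal_mulVec]
    exact hstab _ c hc (fun k hk => by rw [← torusAct_eq_diagonal_mulVec]; exact hT₁ τ hτ k hk) hGA v hv
  exact ⟨K₀, hdim₀.trans hdim₁, graded_of_torusStable w K₀ hT₀, hA₀, hZ₀⟩

end Summit.ValiantsHypothesis.ValiantsHypothesis.Theorems.GrenetZeon.InitialForm.UnipotentClosure
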